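import Literature.Analysis.FluidPDE.HardSphereCollisionRecord
import Literature.MathematicalPhysics.KineticTheory.HardSphereEuler
import HarnessLib

/-!
# At most `K + 1` own records below the predictable count clamp `K` (helper `ccb5_own_records_le`
# of the line `birth`, crux `TwoClocks.EquilibriumFastWindowLD`, stmt-AtomisticToContinuum-14440)

Along a hard-sphere trajectory in a regular geometry the collisions are binary, so particle `i`
has exactly ONE ordered record with `fst = i` at each of its collision times and none elsewhere
(`sum_contactPairs_ite_fst_eq`). List the collision times of `i` in a window `(0, w]` increasingly,
`t₁ < t₂ < ⋯`; the PREDICTABLE own count at `t_k` — the collision sum of `𝟙[fst = i]` over the OPEN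
past `(0, t_k)`, the clamp variable `cnt i t z` of the pair-clamped streams of the line `birth` — is
`k - 1` (`collisionSum_ite_fst_Ioo_eq_card_filter_lt`: it is the number of own collision times
`< t_k`, a strictly increasing function of `t_k`). Hence for every threshold `K ≥ 0` the number of
own records in `(0, w]` whose predictable count is `≤ K` is at most `⌊K⌋ + 1 ≤ K + 1`
(`card_filter_ownCount_le`), and in flow form on `𝕋³` (`ccb5_own_records_le`, registered helper):

`Σ_{records c in (0,w]} 𝟙[c.fst = i ∧ cnt i c.time z ≤ K] ≤ K + 1`.

Use (finiteness of the clamped functionals of the line `birth`): a record RETAINED by the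
pair-clamped streams has `ω_fst = 1`, in particular `cnt_fst(t_c) ≤ Vτ`, so every particle has at
most `Vτ + 1` retained own records in the window (D₁'s a-priori bound, the `(2Vτ+4) Σ_i Ψ(S_i)`
bound of the run census D₄, the bookkeeping of the transfer T).

References: Gallagher–Saint-Raymond–Texier 2013 §4.1 (binary collisions of the hard-sphere flow);
Cercignani–Illner–Pulvirenti 1994 §4.2.
-/

noncomputable section

open MeasureTheory Set
open scoped ENNReal BigOperators

namespace Summit.AtomisticToContinuum.HydrodynamicLimit.Theorems.ClampedCorrectorBirth

open Literature.Analysis.FluidPDE Literature.MathematicalPhysics.KineticTheory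

section Trajectory

variable {d : Type*} [Fintype d] {X : Type*} [TopologicalSpace X] {n : ℕ}
  {G : Geometry d X} {ε : ℝ} {γ : ℝ → Config n d X}

open scoped Classical in
/-- **One own record per own collision.** At a collision time of a hard-sphere trajectory in a
regular geometry, the sum over the ordered contact pairs `p` of `if p.1 = i then x else 0` is `x` if
`i` participates in the collision and `0` otherwise (the contact pairs are `(p, q), (q, p)` with
`p ≠ q`). -/
theorem sum_contactPairs_ite_fst_eq {M : Type*} [AddCommMonoid M] (h : IsHardSphereTrajectory G ε n γ)
    (hG : G.IsHardSphereRegular ε) {t : ℝ} (ht : t ∈ collisionTimes G ε γ) (i : Fin n) (x : M) :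
    ∑ p ∈ contactPairs G ε (γ t), (if p.1 = i then x else 0) =
      if Participates G ε (γ t) i then x else 0 := by
  obtain ⟨⟨p, q⟩, hp⟩ := mem_collisionTimes_iff_contactPairs_nonempty.1 ht
  have hpq : p ≠ q := (mem_contactPairs.1 hp).1
  have hne : (p, q) ≠ (q, p) := fun hpe => hpq (Prod.mk.inj hpe).1
  rw [h.contactPairs_eq_pair hG hp, Finset.sum_pair hne]
  by_cases hi : Participates G ε (γ t) i
  · rw [if_pos hi]
    rcases (h.participates_iff hp).1 hi with rfl | rfl
    · rw [if_pos rfl, if_neg hpq.symm, add_zero]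
    · rw [if_neg hpq, if_pos rfl, zero_add]
  · rw [if_neg hi]
    have hp' : p ≠ i := fun h' => hi ((h.participates_iff hp).2 (Or.inl h'.symm))
    have hq' : q ≠ i := fun h' => hi ((h.participates_iff hp).2 (Or.inr h'.symm))
    rw [if_neg hp', if_neg hq', add_zero]

open scoped Classical in
/-- **The predictable own count is the rank.** Along a hard-sphere trajectory in a regular
geometry, for `0 < t ≤ w` the collision sum of `𝟙[fst = i]` over the OPEN past `(0, t)` is the
number of collision times of `i` in `(0, w]` that are `< t`. -/
theorem collisionSum_ite_fst_Ioo_eq_card_filter_lt (h : IsHardSphereTrajectory G ε n γ)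
    (hG : G.IsHardSphereRegular ε) {w : ℝ}
    (hfin : (collisionTimes G ε γ ∩ Ioc 0 w).Finite) (i : Fin n) {t : ℝ} (htw : t ≤ w) :
    collisionSum G ε γ (Ioo 0 t) (fun c => if c.fst = i then (1 : ℝ) else 0) =
      (((hfin.toFinset.filter fun s => Participates G ε (γ s) i).filter fun s => s < t).card : ℝ) := by
  have hfin' : (collisionTimes G ε γ ∩ Ioo 0 t).Finite :=
    h.finite_collisionTimes_inter_of_subset_Icc Ioo_subset_Icc_self
  rw [collisionSum_eq_finset_sum hfin']
  simp only [HardSphereCollisionRecord.ofConfig_fst]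
  rw [Finset.sum_congr rfl fun s hs =>
    sum_contactPairs_ite_fst_eq h hG ((Set.Finite.mem_toFinset hfin').1 hs).1 i (1 : ℝ),
    ← Finset.sum_filter, Finset.sum_const, nsmul_eq_mul, mul_one]
  congr 2
  ext s
  simp only [Finset.mem_filter, Set.Finite.mem_toFinset, mem_inter_iff, mem_Ioo, mem_Ioc]
  constructor
  · rintro ⟨⟨hs, h0s, hst⟩, hps⟩
    exact ⟨⟨⟨hs, h0s, hst.le.trans htw⟩, hps⟩, hst⟩
  · rintro ⟨⟨⟨hs, h0s, -⟩, hps⟩, hst⟩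
    exact ⟨⟨hs, h0s, hst⟩, hps⟩

open scoped Classical in
/-- **At most `⌊K⌋ + 1` own collision times have rank `≤ K`.** For a finite set `A` of reals and
`0 ≤ K`, the elements `t ∈ A` preceded by at most `K` elements of `A` are at most `⌊K⌋₊ + 1` in
number: the rank `t ↦ #{s ∈ A | s < t}` is injective on `A`. -/
theorem card_filter_rank_le (A : Finset ℝ) {K : ℝ} (hK : 0 ≤ K) :
    ((A.filter fun t => (((A.filter fun s => s < t).card : ℕ) : ℝ) ≤ K).card : ℝ) ≤ K + 1 := by
  set B := A.filter fun t => (((A.filter fun s => s < t).card : ℕ) : ℝ) ≤ K with hB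
  have hinj : Set.InjOn (fun t => (A.filter fun s => s < t).card) (B : Set ℝ) := by
    intro s hs t ht hst
    by_contra hne
    rcases lt_or_gt_of_ne hne with hlt | hlt
    · have hsub : (A.filter fun r => r < s) ⊂ (A.filter fun r => r < t) := by
        rw [Finset.ssubset_iff_subset_ne]
        refine ⟨fun r hr => ?_, fun heq => ?_⟩
        · obtain ⟨hrA, hrs⟩ := Finset.mem_filter.1 hr
          exact Finset.mem_filter.2 ⟨hrA, hrs.trans hlt⟩
        · have hsA : s ∈ A := (Finset.mem_filter.1 (Finset.mem_coe.1 hs)).1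
          have hmem : s ∈ A.filter fun r => r < t := Finset.mem_filter.2 ⟨hsA, hlt⟩
          rw [← heq] at hmem
          exact lt_irrefl s (Finset.mem_filter.1 hmem).2
      exact absurd hst (Finset.card_lt_card hsub).ne
    · have hsub : (A.filter fun r => r < t) ⊂ (A.filter fun r => r < s) := by
        rw [Finset.ssubset_iff_subset_ne]
        refine ⟨fun r hr => ?_, fun heq => ?_⟩
        · obtain ⟨hrA, hrt⟩ := Finset.mem_filter.1 hr
          exact Finset.mem_filter.2 ⟨hrA, hrt.trans hlt⟩
        · have htA : t ∈ A := (Finset.mem_filter.1 (Finset.mem_coe.1 ht)).1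
          have hmem : t ∈ A.filter fun r => r < s := Finset.mem_filter.2 ⟨htA, hlt⟩
          rw [← heq] at hmem
          exact lt_irrefl t (Finset.mem_filter.1 hmem).2
      exact absurd hst.symm (Finset.card_lt_card hsub).ne
  have hmaps : ∀ t ∈ B, (fun t => (A.filter fun s => s < t).card) t ∈ Finset.range (⌊K⌋₊ + 1) := by
    intro t ht
    have hle : (((A.filter fun s => s < t).card : ℕ) : ℝ) ≤ K := (Finset.mem_filter.1 ht).2
    exact Finset.mem_range.2 (Nat.lt_succ_of_le ((Nat.le_floor_iff hK).2 hle))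
  have hcard : B.card ≤ ⌊K⌋₊ + 1 := by
    simpa only [Finset.card_range] using Finset.card_le_card_of_injOn _ hmaps hinj
  calc (B.card : ℝ) ≤ ((⌊K⌋₊ + 1 : ℕ) : ℝ) := by exact_mod_cast hcard
    _ = (⌊K⌋₊ : ℝ) + 1 := by push_cast; ring
    _ ≤ K + 1 := by linarith [Nat.floor_le hK]

open scoped Classical in
/-- **At most `K + 1` own records below the predictable count `K`** (trajectory form). Along a
hard-sphere trajectory in a regular geometry, for every particle `i`, window `(0, w]` and
threshold `0 ≤ K`: the collision sum over the records `c` in `(0, w]` of the indicator of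
`c.fst = i ∧ (own count of i over (0, c.time)) ≤ K` is at most `K + 1`. -/
theorem collisionSum_ite_fst_and_count_le (h : IsHardSphereTrajectory G ε n γ)
    (hG : G.IsHardSphereRegular ε) (i : Fin n) (w : ℝ) {K : ℝ} (hK : 0 ≤ K) :
    collisionSum G ε γ (Ioc 0 w)
        (fun c => if c.fst = i ∧
            collisionSum G ε γ (Ioo 0 c.time) (fun c' => if c'.fst = i then (1 : ℝ) else 0) ≤ K
          then (1 : ℝ) else 0) ≤ K + 1 := by
  have hfin : (collisionTimes G ε γ ∩ Ioc 0 w).Finite :=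
    h.finite_collisionTimes_inter_of_subset_Icc Ioc_subset_Icc_self
  -- time by time, the own indicator with the predictable-count condition
  have hstep : ∀ t ∈ hfin.toFinset,
      ∑ p ∈ contactPairs G ε (γ t),
        (if (HardSphereCollisionRecord.ofConfig G ε (γ t) t p.1 p.2).fst = i ∧
            collisionSum G ε γ (Ioo 0 (HardSphereCollisionRecord.ofConfig G ε (γ t) t p.1 p.2).time)
              (fun c' => if c'.fst = i then (1 : ℝ) else 0) ≤ K then (1 : ℝ) else 0) =
        if Participates G ε (γ t) i ∧
            ((((hfin.toFinset.filter fun s => Participates G ε (γ s) i).filter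
              fun s => s < t).card : ℕ) : ℝ) ≤ K
          then (1 : ℝ) else 0 := by
    intro t ht
    obtain ⟨htc, -, htw⟩ := (Set.Finite.mem_toFinset hfin).1 ht
    simp only [HardSphereCollisionRecord.ofConfig_fst, HardSphereCollisionRecord.ofConfig_time,
      collisionSum_ite_fst_Ioo_eq_card_filter_lt h hG hfin i htw]
    by_cases hQ : ((((hfin.toFinset.filter fun s => Participates G ε (γ s) i).filter
        fun s => s < t).card : ℕ) : ℝ) ≤ K
    · simp only [hQ, and_true]
      exact sum_contactPairs_ite_fst_eq h hG htc i (1 : ℝ)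
    · simp only [hQ, and_false, if_false, Finset.sum_const_zero]
  rw [collisionSum_eq_finset_sum hfin, Finset.sum_congr rfl hstep, ← Finset.sum_filter,
    Finset.sum_const, nsmul_eq_mul, mul_one, ← Finset.filter_filter]
  exact card_filter_rank_le _ hK

end Trajectory

/-- **At most `K + 1` own records below the predictable count clamp** (flow form on `𝕋³`). For
reduced diameter `0 < σ < 1/2`, a flow `Φ` of `N + 1` spheres, a GOOD initial datum `z`, a particle
`i`, a threshold `0 ≤ K` and a window end `w`: the number of records `c` of the orbit with
`c.time ∈ (0, w]`, `c.fst = i` and predictable own count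
`cnt i c.time z = Σ_{records in (0, c.time), fst = i} 1 ≤ K` is at most `K + 1` — the own records of
`i` occur at distinct times (binary collisions) and the `k`-th of them has predictable count
`k - 1`. With `K = V·τ` this is the bound "an on particle has at most `Vτ + 1` retained own
records" behind the finiteness of the pair-clamped streams (D₁/D₂), of the run census (D₄:
`Cont ≤ (2Vτ+4) Σ_i Ψ(S_i)`) and of the transfer bookkeeping (T) of the line `birth` (monotonicity:
the retained weight `ω_fst ω_snd` is at most the indicator of `cnt_fst ≤ Vτ`). -/
theorem ccb5_own_records_le : ∀ (σ : ℝ), 0 < σ → σ < 2⁻¹ → ∀ (N : ℕ)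
    (Φ : HardSphereFlow (Torus.geometry (Fin 3)) (hsDiameter σ N) (N + 1))
    (z : Config (N + 1) (Fin 3) T3), z ∈ Φ.good → ∀ (i : Fin (N + 1)) (K w : ℝ), 0 ≤ K →
    Φ.collisionSum (Set.Ioc 0 w)
        (fun c => if c.fst = i ∧
            Φ.collisionSum (Set.Ioo 0 c.time) (fun c' => if c'.fst = i then (1 : ℝ) else 0) z ≤ K
          then (1 : ℝ) else 0) z ≤ K + 1 := by
  intro σ hσ hσ2 N Φ z hz i K w hK
  have hG : (Torus.geometry (Fin 3)).IsHardSphereRegular (hsDiameter σ N) :=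
    Torus.isHardSphereRegular_geometry ((hsDiameter_le hσ.le N).trans_lt hσ2)
  simp only [HardSphereFlow.collisionSum_eq]
  exact collisionSum_ite_fst_and_count_le (Φ.isTrajectory z hz) hG i w hK

end Summit.AtomisticToContinuum.HydrodynamicLimit.Theorems.ClampedCorrectorBirth
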